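import Mathlib
import HarnessLib
import Summits.Ventures.LatticeQCDFlow.StatementStaircase
import Summits.Ventures.LatticeQCDFlow.TrivializingMaps.AcceptanceFootprintExact
import Summits.Ventures.LatticeQCDFlow.TrivializingMaps.FisherZeroNearCouplingSharp
import Summits.Ventures.LatticeQCDFlow.TrivializingMaps.WilsonStaircaseCountExplicit
import Summits.Ventures.LatticeQCDFlow.TrivializingMaps.StaircaseMeanActionLaw
import Summits.Ventures.LatticeQCDFlow.TrivializingMaps.WilsonFisherZerosExtensive

/-!
# Venture statement — LatticeQCDFlow — DRAFT, Part T16–T18: THE SHARP ACCEPTANCE–FOOTPRINT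
# FUNCTION, AND WHERE THE FISHER ZEROS ARE (SHARP CONSTANTS)

HONEST FRAMING: exact (Metropolis-corrected) sampling algorithms for lattice gauge theory;
figures of merit are autocorrelation/cost numbers at stated couplings and volumes; no
continuum-physics claim.

This file CONTINUES the venture's `Statement.lean` DRAFT (FANOUT-PLAN.md row 31, lean-2; review-queued;
it STAYS A DRAFT until the operator adopts it), after `StatementStaircase.lean` (Parts T10–T15).  It is
a separate module only because of the tree's 400-line limit; on adoption the operator may merge the
four.  As before, every `Prop` is a typed statement over the landed substrate with a `_holds` theorem
next to it, and `TheoryStatementT18 := TheoryStatementT15 ∧ T16 ∧ T17 ∧ T18` is PROVED.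

* **T16 (THE SHARP ACCEPTANCE–FOOTPRINT FUNCTION — THEOREM Q♯♯ on the whole range, theory-1 rows
  94b, 96a–96h)** — with `G(acc) := 1` for `acc ≤ ½` and `4·acc·(1 - acc)` for `acc ≥ ½`
  (`= 1 - ((2acc - 1)₊)²`): (i) in `SU(n)` lattice gauge theory with ANY continuous action, at every
  coupling and in every periodic volume, an exact (Metropolis-corrected) independence proposal that
  is the push-forward of `D[U]` under a measurable map of range `r`, with equilibrium mean acceptance
  `≥ acc`, satisfies `|⟨AB⟩ - ⟨A⟩⟨B⟩| ≤ G(acc) · a b` for all measurable witnesses `|A| ≤ a`,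
  `|B| ≤ b` (`a, b > 0`) supported on link sets more than `2r` apart
  (`TrivializingMaps.abs_cov_le_mul_of_abs_le` below `½`, row 96g;
  `TrivializingMaps.Curve.Gauge.abs_cov_boltzmann_le_curve_of_meanAccept` above `½`, row 96e — the
  four-point block inequality `Curve.blockIneq`, row 96d); (ii) `G` is the LEAST acceptance-only law:
  every `g` with `|Cov| ≤ g(acc)·ab` under the hypotheses of THEOREM Q already on two binary links
  satisfies `G ≤ g` on `[0, 1]` (`TrivializingMaps.Sharp.exact_law_isLeast`, row 96h: the floor and
  corner families of `AcceptanceFootprintFloor`).  Reading (value-free): an exact trivialised proposal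
  that decorrelates a witness pair of normalised strength `m = |Cov|/(ab)` has equilibrium acceptance
  at most `(1 + √(1 - m))/2`.
* **T17 (WHERE THE FINITE-VOLUME WILSON FISHER ZEROS ARE — sharp constants, lean-2 GEN-7)** — with
  `m₂(n) = ∫_{SU(n)} (Re tr)² dHaar`: for every `d ≥ 2`, `n ≥ 2` and EVERY `L ≥ 2` the `SU(n)` Wilson
  partition function `Z_L(s) = ∫ D[U] e^{-sS_W}` has a zero with `|s₀| ≤ 4n/m₂(n)` — **`|s₀| ≤ 8` for
  `SU(2)`, `|s₀| ≤ 8n` for `n ≥ 3`** — and every THEOREM-A volume-uniform radius obeys the same bounds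
  (`TrivializingMaps.wilson_exists_fisherZero_norm_le`, `…wilson_su2_exists_fisherZero_norm_le`,
  `…wilson_su2_theoremA_radius_le_eight`, `…wilson_sun_exists_fisherZero_norm_le`,
  `…wilson_sun_theoremA_radius_le_eight_mul`; the coefficient form of the Borel–Carathéodory lemma,
  `Literature.Analysis.Complex.borelCaratheodory_norm_iteratedDeriv_le_of_ball`, replaces T15's
  `1280` / `512(2n+1)`).
* **T18 (THE SPECIFIC HEAT AT A COUPLING BOUNDS THE DISTANCE TO THE NEAREST FISHER ZERO)** — for
  every smooth action with `|S∘ι - c| ≤ b`, every volume and every real coupling `x` at which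
  `Var_x(S∘ι) > 0` (variance in `𝒵⁻¹e^{-xS}D[U]`): a zero `s₀` of `Z` with
  `|s₀ - x| ≤ 4|b| / Var_x(S∘ι)`; for the Wilson action (`b = c = n·#plaq`):
  `dist(x, F_{Z_L}) ≤ 4n·#plaq / Var_{wilsonMeasure ρ₀ x}(S_W)`, i.e. `4n` over the specific heat per
  plaquette (`TrivializingMaps.exists_actionZ_eq_zero_near_norm_le`,
  `TrivializingMaps.wilson_infDist_zeroSet_le`); with T10 every staircase stage centred at `x` is at
  most `(1-η)` times that.

NOT part of the binding text: any value of an acceptance, covariance, variance or zero location for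
any concrete flow, coupling or volume beyond what the tree proves; sharpness of the constants `4`,
`8`, `8n`; `L = 1`; cost / autocorrelation / continuum statements.
-/

namespace Summit.Ventures.LatticeQCDFlow

open MeasureTheory ProbabilityTheory Metric
open Literature.MathematicalPhysics.QuantumFieldTheory
open Literature.MathematicalPhysics.QuantumFieldTheory.Luscher2010
open Literature.MathematicalPhysics.QuantumFieldTheory.WilsonFlow (coeConfig)
open scoped Matrix Matrix.Norms.Frobenius ContDiff

section PartT16

/-- **T16 — THE SHARP ACCEPTANCE–FOOTPRINT FUNCTION `G(acc) = 1 - ((2acc - 1)₊)²`: (i) the law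
`|Cov_π(A,B)| ≤ G(acc)·ab` for exact range-`r` push-forward proposals in `SU(n)` lattice gauge theory
(any continuous action, coupling, volume; witnesses more than `2r` apart); (ii) minimality of `G` among
acceptance-only laws (two binary links, counting reference measure).** -/
def T16_SharpAcceptanceFootprint : Prop :=
  (∀ (d L n : ℕ) [NeZero L] (S : GaugeConfig d L (Matrix.specialUnitaryGroup (Fin n) ℂ) → ℝ),
    Continuous S →
    ∀ (dist : Edge d L → Edge d L → ℕ), (∀ e e', dist e e' = dist e' e) →
      (∀ e e' e'', dist e e'' ≤ dist e e' + dist e' e'') →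
    ∀ (Φ : GaugeConfig d L (Matrix.specialUnitaryGroup (Fin n) ℂ) →
        GaugeConfig d L (Matrix.specialUnitaryGroup (Fin n) ℂ)), Measurable Φ →
    ∀ (q : GaugeConfig d L (Matrix.specialUnitaryGroup (Fin n) ℂ) → ℝ), (∀ U, 0 ≤ q U) →
      Measurable q →
    (trivialMeasure (Matrix.specialUnitaryGroup (Fin n) ℂ) d L).map Φ
      = (trivialMeasure (Matrix.specialUnitaryGroup (Fin n) ℂ) d L).withDensity
          (fun U => ENNReal.ofReal (q U)) →
    ∀ (N : Edge d L → Set (Edge d L)), (∀ e, DependsOn (fun W => Φ W e) (N e)) →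
    ∀ (r : ℕ), (∀ e, ∀ e' ∈ N e, dist e e' ≤ r) →
    ∀ (acc : ℝ), acc ≤ ∫ U, ∫ U', min (Real.exp (-S U) / (partitionFn S).toReal * q U')
        (Real.exp (-S U') / (partitionFn S).toReal * q U)
        ∂(trivialMeasure (Matrix.specialUnitaryGroup (Fin n) ℂ) d L)
        ∂(trivialMeasure (Matrix.specialUnitaryGroup (Fin n) ℂ) d L) →
    ∀ (A B : GaugeConfig d L (Matrix.specialUnitaryGroup (Fin n) ℂ) → ℝ), Measurable A →
      Measurable B → ∀ (a b : ℝ), 0 < a → 0 < b → (∀ U, |A U| ≤ a) → (∀ U, |B U| ≤ b) →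
    ∀ (SA SB : Set (Edge d L)), DependsOn A SA → DependsOn B SB →
      (∀ e ∈ SA, ∀ e' ∈ SB, 2 * r < dist e e') →
    |∫ U, A U * B U ∂(boltzmannMeasure S)
        - (∫ U, A U ∂(boltzmannMeasure S)) * ∫ U, B U ∂(boltzmannMeasure S)|
      ≤ (if acc ≤ 1 / 2 then (1 : ℝ) else 4 * acc * (1 - acc)) * (a * b)) ∧
  (∀ g : ℝ → ℝ, (∀ (p q A B : Bool × Bool → ℝ) (a b acc : ℝ), (∀ z, 0 ≤ p z) → Measurable p →
      Integrable p (Measure.count : Measure (Bool × Bool)) →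
      ∫ z, p z ∂(Measure.count : Measure (Bool × Bool)) = 1 → (∀ z, 0 ≤ q z) → Measurable q →
      Integrable q (Measure.count : Measure (Bool × Bool)) →
      ∫ z, q z ∂(Measure.count : Measure (Bool × Bool)) = 1 →
      acc ≤ ∫ x, ∫ y, min (p x * q y) (p y * q x) ∂(Measure.count : Measure (Bool × Bool))
        ∂(Measure.count : Measure (Bool × Bool)) →
      Measurable A → Measurable B → (∀ z, |A z| ≤ a) → (∀ z, |B z| ≤ b) →
      ∫ z, A z * B z ∂((Measure.count : Measure (Bool × Bool)).withDensity
          fun z => ENNReal.ofReal (q z))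
        = (∫ z, A z ∂((Measure.count : Measure (Bool × Bool)).withDensity
            fun z => ENNReal.ofReal (q z)))
          * ∫ z, B z ∂((Measure.count : Measure (Bool × Bool)).withDensity
            fun z => ENNReal.ofReal (q z)) →
      |∫ z, A z * B z ∂((Measure.count : Measure (Bool × Bool)).withDensity
          fun z => ENNReal.ofReal (p z))
        - (∫ z, A z ∂((Measure.count : Measure (Bool × Bool)).withDensity
            fun z => ENNReal.ofReal (p z)))
          * ∫ z, B z ∂((Measure.count : Measure (Bool × Bool)).withDensity
            fun z => ENNReal.ofReal (p z))|
        ≤ g acc * (a * b)) →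
      ∀ acc : ℝ, 0 ≤ acc → acc ≤ 1 →
        (if acc ≤ 1 / 2 then (1 : ℝ) else 4 * acc * (1 - acc)) ≤ g acc)

/-- T16 holds (`TrivializingMaps.abs_cov_le_mul_of_abs_le` — row 96g — below `½`;
`TrivializingMaps.Curve.Gauge.abs_cov_boltzmann_le_curve_of_meanAccept` — row 96e — above `½`;
`TrivializingMaps.Sharp.exact_law_isLeast` — row 96h — for minimality). -/
theorem T16_SharpAcceptanceFootprint_holds : T16_SharpAcceptanceFootprint := by
  refine ⟨?_, fun g hlaw acc h0 h1 => TrivializingMaps.Sharp.exact_law_isLeast.2 g hlaw acc h0 h1⟩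
  intro d L n _ S hS dist hsymm htri Φ hΦm q hq0 hqm hν N hΦ r hN acc hacc A B hAm hBm a b ha hb
    hAa hBb SA SB hA hB hsep
  split_ifs with h
  · haveI := TrivializingMaps.isProbabilityMeasure_boltzmannMeasure (d := d) (L := L) hS
    rw [one_mul]
    exact TrivializingMaps.abs_cov_le_mul_of_abs_le (boltzmannMeasure S) hAm hBm hAa hBb
  · exact TrivializingMaps.Curve.Gauge.abs_cov_boltzmann_le_curve_of_meanAccept hS dist hsymm htri
      hΦm hq0 hqm hν hΦ hN hacc (le_of_lt (not_le.mp h)) hAm hBm ha hb hAa hBb hA hB hsep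

end PartT16

section PartT17

/-- **T17 — THE FINITE-VOLUME WILSON FISHER ZEROS: one with `|s₀| ≤ 4n/m₂(n)` in EVERY volume
(`d ≥ 2`, `L ≥ 2`, `n ≥ 2`), explicitly `|s₀| ≤ 8` for `SU(2)` and `|s₀| ≤ 8n` for `n ≥ 3`, with the
same bounds on every THEOREM-A volume-uniform radius.** -/
def T17_WilsonFisherZeroRadiusSharp : Prop :=
  (∀ (d L n : ℕ) [NeZero L], 2 ≤ d → 2 ≤ n → 2 ≤ L →
    ∃ s₀ : ℂ, ‖s₀‖ ≤ 4 * n /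
        ∫ g, ((g : Matrix (Fin n) (Fin n) ℂ)).trace.re ^ 2
          ∂(haarProbability (Matrix.specialUnitaryGroup (Fin n) ℂ)) ∧
      complexMGF (fun U => -TrivializingMaps.ambWilsonAction (coeConfig U))
        (trivialMeasure (Matrix.specialUnitaryGroup (Fin n) ℂ) d L) s₀ = 0) ∧
  (∀ (d L : ℕ) [NeZero L], 2 ≤ d → 2 ≤ L →
    ∃ s₀ : ℂ, ‖s₀‖ ≤ 8 ∧
      complexMGF (fun U => -TrivializingMaps.ambWilsonAction (coeConfig U))
        (trivialMeasure (Matrix.specialUnitaryGroup (Fin 2) ℂ) d L) s₀ = 0) ∧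
  (∀ (d : ℕ), 2 ≤ d → ∀ (ρ C : ℝ), 0 < ρ →
    (∀ (L : ℕ) [NeZero L] (B : SuBasis 2) (Sk : ℕ → AmbConfig d L 2 → ℝ) (c : ℕ → ℝ),
      (∀ k, ContDiff ℝ ∞ (Sk k)) → IsLuscherSeries B TrivializingMaps.ambWilsonAction Sk c →
      ∀ (k : ℕ) (U : GaugeConfig d L (Matrix.specialUnitaryGroup (Fin 2) ℂ)) (e : Edge d L)
        (a : B.ι), |linkDeriv e (B.T a) (Sk k) (coeConfig U)| ≤ C * ρ⁻¹ ^ k) →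
    SuBasis 2 → ρ ≤ 8) ∧
  (∀ (d L n : ℕ) [NeZero L], 2 ≤ d → 3 ≤ n → 2 ≤ L →
    ∃ s₀ : ℂ, ‖s₀‖ ≤ 8 * n ∧
      complexMGF (fun U => -TrivializingMaps.ambWilsonAction (coeConfig U))
        (trivialMeasure (Matrix.specialUnitaryGroup (Fin n) ℂ) d L) s₀ = 0) ∧
  (∀ (d n : ℕ), 2 ≤ d → 3 ≤ n → ∀ (ρ C : ℝ), 0 < ρ →
    (∀ (L : ℕ) [NeZero L] (B : SuBasis n) (Sk : ℕ → AmbConfig d L n → ℝ) (c : ℕ → ℝ),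
      (∀ k, ContDiff ℝ ∞ (Sk k)) → IsLuscherSeries B TrivializingMaps.ambWilsonAction Sk c →
      ∀ (k : ℕ) (U : GaugeConfig d L (Matrix.specialUnitaryGroup (Fin n) ℂ)) (e : Edge d L)
        (a : B.ι), |linkDeriv e (B.T a) (Sk k) (coeConfig U)| ≤ C * ρ⁻¹ ^ k) →
    SuBasis n → ρ ≤ 8 * n)

/-- T17 holds (`TrivializingMaps.wilson_exists_fisherZero_norm_le`,
`TrivializingMaps.wilson_su2_exists_fisherZero_norm_le`, `TrivializingMaps.wilson_su2_theoremA_radius_le_eight`,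
`TrivializingMaps.wilson_sun_exists_fisherZero_norm_le`,
`TrivializingMaps.wilson_sun_theoremA_radius_le_eight_mul`). -/
theorem T17_WilsonFisherZeroRadiusSharp_holds : T17_WilsonFisherZeroRadiusSharp :=
  ⟨fun _ _ _ _ hd hn hL => TrivializingMaps.wilson_exists_fisherZero_norm_le hd hn hL,
    fun _ _ _ hd hL => TrivializingMaps.wilson_su2_exists_fisherZero_norm_le hd hL,
    fun _ hd _ _ hρ hA B => TrivializingMaps.wilson_su2_theoremA_radius_le_eight hd hρ hA B,
    fun _ _ _ _ hd hn hL => TrivializingMaps.wilson_sun_exists_fisherZero_norm_le hd hn hL,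
    fun _ _ hd hn _ _ hρ hA B => TrivializingMaps.wilson_sun_theoremA_radius_le_eight_mul hd hn hρ hA B⟩

end PartT17

section PartT18

/-- **T18 — THE VARIANCE OF THE ACTION AT COUPLING `x` BOUNDS THE DISTANCE TO THE NEAREST FISHER
ZERO: `|s₀ - x| ≤ 4·(half-range)/Var_x(S∘ι)`** (every smooth action, every volume), and for the Wilson
action `dist(x, F_{Z_L}) ≤ 4n·#plaquettes / Var_{wilsonMeasure ρ₀ x}(S_W)`. -/
def T18_FisherZeroNearCouplingSharp : Prop :=
  (∀ (d L n : ℕ) [NeZero L] (S : AmbConfig d L n → ℝ), ContDiff ℝ ∞ S → ∀ (c b : ℝ),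
    (∀ U : GaugeConfig d L (Matrix.specialUnitaryGroup (Fin n) ℂ), |S (coeConfig U) - c| ≤ b) →
    ∀ (x : ℝ), 0 < variance (fun U => S (coeConfig U))
      (boltzmannMeasure fun U : GaugeConfig d L (Matrix.specialUnitaryGroup (Fin n) ℂ) =>
        x * S (coeConfig U)) →
    ∃ s₀ : ℂ, ‖s₀ - x‖ ≤ 4 * |b| / variance (fun U => S (coeConfig U))
        (boltzmannMeasure fun U : GaugeConfig d L (Matrix.specialUnitaryGroup (Fin n) ℂ) =>
          x * S (coeConfig U)) ∧
      complexMGF (fun U => -S (coeConfig U))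
        (trivialMeasure (Matrix.specialUnitaryGroup (Fin n) ℂ) d L) s₀ = 0) ∧
  (∀ (d L n : ℕ) [NeZero L] (x : ℝ),
    0 < variance (wilsonAction (TrivializingMaps.StrongCoupling.defRep n))
        (wilsonMeasure (d := d) (L := L) (TrivializingMaps.StrongCoupling.defRep n) x) →
    infDist (x : ℂ) {s : ℂ | complexMGF (fun U => -TrivializingMaps.ambWilsonAction (coeConfig U))
      (trivialMeasure (Matrix.specialUnitaryGroup (Fin n) ℂ) d L) s = 0} ≤
      4 * (n * Fintype.card (Plaquette d L)) /
        variance (wilsonAction (TrivializingMaps.StrongCoupling.defRep n))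
          (wilsonMeasure (d := d) (L := L) (TrivializingMaps.StrongCoupling.defRep n) x))

/-- T18 holds (`TrivializingMaps.exists_actionZ_eq_zero_near_norm_le`,
`TrivializingMaps.wilson_infDist_zeroSet_le`). -/
theorem T18_FisherZeroNearCouplingSharp_holds : T18_FisherZeroNearCouplingSharp :=
  ⟨fun _ _ _ _ _ hS _ _ hb x hvar => TrivializingMaps.exists_actionZ_eq_zero_near_norm_le hS hb x hvar,
    fun _ _ _ _ x hvar => TrivializingMaps.wilson_infDist_zeroSet_le x hvar⟩

end PartT18

/-- **The theory conjunction with the sharp footprint function and the sharp zero locations**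
(DRAFT): `TheoryStatementT15 ∧ T16 ∧ T17 ∧ T18`. -/
def TheoryStatementT18 : Prop :=
  TheoryStatementT15 ∧ T16_SharpAcceptanceFootprint ∧ T17_WilsonFisherZeroRadiusSharp ∧
    T18_FisherZeroNearCouplingSharp

/-- The extended theory conjunction holds. -/
theorem TheoryStatementT18_holds : TheoryStatementT18 :=
  ⟨TheoryStatementT15_holds, T16_SharpAcceptanceFootprint_holds,
    T17_WilsonFisherZeroRadiusSharp_holds, T18_FisherZeroNearCouplingSharp_holds⟩


/-! ### Appended (lean-2 GEN-7, second pass): Part T19–T20 — TWO STAGE-COUNT LAWS WITH NO UNLOCATED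
QUANTITY IN THEM

* **T19 (explicit, volume-independent stage count, Wilson action)** — for `d ≥ 2`, `n ≥ 2`, EVERY
  `L ≥ 2`, every `0 < η < 1` and every `η`-margined admissible staircase `0 ≤ x₀ ≤ … ≤ x_K` of
  re-expanded flow-constant series of `S_W`: `log((x_K + ρ_n)/(x₀ + ρ_n)) ≤ K·log(1/η)` with
  `ρ_n = 4n/m₂(n)` — `log((x_K + 8)/(x₀ + 8))` for `SU(2)`, `log((x_K + 8n)/(x₀ + 8n))` for `n ≥ 3`
  (`TrivializingMaps.wilson_staircase_count_ge_log`, `…wilson_su2_staircase_count_ge_log`,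
  `…wilson_sun_staircase_count_ge_log`: THEOREM S with the located zero of T17).
* **T20 (the mean action pays for the stages)** — for every smooth action with `|S∘ι − c| ≤ b`, every
  volume, every `0 < η < 1` and every `η`-margined admissible staircase `x₀ ≤ … ≤ x_K`:
  `⟨S⟩_{x₀} − ⟨S⟩_{x_K} ≤ 4|b|·K·log(1/η)` (means in `𝒵⁻¹e^{-xS}D[U]`); for the Wilson action
  `⟨S_W⟩_{x₀} − ⟨S_W⟩_{x_K} ≤ 4n·#plaq·K·log(1/η)` under `wilsonMeasure ρ₀ x` — one stage lowers the
  mean plaquette action by at most `4n·log(1/η)`, in every volume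
  (`TrivializingMaps.Staircase.meanAction_drop_le`, `TrivializingMaps.wilson_meanAction_drop_le`:
  THEOREM S several-zeros form + T18 + the integrated fluctuation relation
  `⟨S⟩_a − ⟨S⟩_b = ∫_a^b Var_t(S) dt`).  NOT binding: any value of a mean action at any coupling;
  that either bound is near the true count. -/

section PartT19

/-- **T19 — EXPLICIT VOLUME-INDEPENDENT STAGE COUNT for the `SU(n)` Wilson action:
`log((x_K + 4n/m₂(n))/(x₀ + 4n/m₂(n))) ≤ K·log(1/η)`, explicitly with `8` for `SU(2)` and `8n` for
`n ≥ 3`.** -/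
def T19_WilsonStaircaseCountExplicit : Prop :=
  (∀ (d L n : ℕ) [NeZero L], 2 ≤ d → 2 ≤ n → 2 ≤ L → ∀ (η : ℝ), 0 < η → η < 1 →
    ∀ (K : ℕ) (x : ℕ → ℝ), 0 ≤ x 0 → (∀ k < K, x k ≤ x (k + 1)) →
    (∀ k < K, Summable fun j : ℕ => (j.factorial : ℂ)⁻¹ *
      iteratedDeriv j (fun w => deriv (complexMGF
          (fun U => -TrivializingMaps.ambWilsonAction (coeConfig U))
          (trivialMeasure (Matrix.specialUnitaryGroup (Fin n) ℂ) d L)) w /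
        complexMGF (fun U => -TrivializingMaps.ambWilsonAction (coeConfig U))
          (trivialMeasure (Matrix.specialUnitaryGroup (Fin n) ℂ) d L) w) (x k) *
      (((x k + (x (k + 1) - x k) / (1 - η) : ℝ) : ℂ) - x k) ^ j) →
    Real.log ((x K + 4 * n / ∫ g, ((g : Matrix (Fin n) (Fin n) ℂ)).trace.re ^ 2
          ∂(haarProbability (Matrix.specialUnitaryGroup (Fin n) ℂ))) /
        (x 0 + 4 * n / ∫ g, ((g : Matrix (Fin n) (Fin n) ℂ)).trace.re ^ 2
          ∂(haarProbability (Matrix.specialUnitaryGroup (Fin n) ℂ)))) ≤ K * Real.log (1 / η)) ∧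
  (∀ (d L : ℕ) [NeZero L], 2 ≤ d → 2 ≤ L → ∀ (η : ℝ), 0 < η → η < 1 →
    ∀ (K : ℕ) (x : ℕ → ℝ), 0 ≤ x 0 → (∀ k < K, x k ≤ x (k + 1)) →
    (∀ k < K, Summable fun j : ℕ => (j.factorial : ℂ)⁻¹ *
      iteratedDeriv j (fun w => deriv (complexMGF
          (fun U => -TrivializingMaps.ambWilsonAction (coeConfig U))
          (trivialMeasure (Matrix.specialUnitaryGroup (Fin 2) ℂ) d L)) w /
        complexMGF (fun U => -TrivializingMaps.ambWilsonAction (coeConfig U))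
          (trivialMeasure (Matrix.specialUnitaryGroup (Fin 2) ℂ) d L) w) (x k) *
      (((x k + (x (k + 1) - x k) / (1 - η) : ℝ) : ℂ) - x k) ^ j) →
    Real.log ((x K + 8) / (x 0 + 8)) ≤ K * Real.log (1 / η)) ∧
  (∀ (d L n : ℕ) [NeZero L], 2 ≤ d → 3 ≤ n → 2 ≤ L → ∀ (η : ℝ), 0 < η → η < 1 →
    ∀ (K : ℕ) (x : ℕ → ℝ), 0 ≤ x 0 → (∀ k < K, x k ≤ x (k + 1)) →
    (∀ k < K, Summable fun j : ℕ => (j.factorial : ℂ)⁻¹ *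
      iteratedDeriv j (fun w => deriv (complexMGF
          (fun U => -TrivializingMaps.ambWilsonAction (coeConfig U))
          (trivialMeasure (Matrix.specialUnitaryGroup (Fin n) ℂ) d L)) w /
        complexMGF (fun U => -TrivializingMaps.ambWilsonAction (coeConfig U))
          (trivialMeasure (Matrix.specialUnitaryGroup (Fin n) ℂ) d L) w) (x k) *
      (((x k + (x (k + 1) - x k) / (1 - η) : ℝ) : ℂ) - x k) ^ j) →
    Real.log ((x K + 8 * n) / (x 0 + 8 * n)) ≤ K * Real.log (1 / η))

/-- T19 holds (`TrivializingMaps.wilson_staircase_count_ge_log`,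
`TrivializingMaps.wilson_su2_staircase_count_ge_log`, `TrivializingMaps.wilson_sun_staircase_count_ge_log`). -/
theorem T19_WilsonStaircaseCountExplicit_holds : T19_WilsonStaircaseCountExplicit :=
  ⟨fun _ _ _ _ hd hn hL _ hη0 hη1 _ _ hx0 hmono hadm =>
      TrivializingMaps.wilson_staircase_count_ge_log hd hn hL hη0 hη1 hx0 hmono hadm,
    fun _ _ _ hd hL _ hη0 hη1 _ _ hx0 hmono hadm =>
      TrivializingMaps.wilson_su2_staircase_count_ge_log hd hL hη0 hη1 hx0 hmono hadm,
    fun _ _ _ _ hd hn hL _ hη0 hη1 _ _ hx0 hmono hadm =>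
      TrivializingMaps.wilson_sun_staircase_count_ge_log hd hn hL hη0 hη1 hx0 hmono hadm⟩

end PartT19

section PartT20

/-- **T20 — THE MEAN ACTION PAYS FOR THE STAGES: `⟨S⟩_{x₀} − ⟨S⟩_{x_K} ≤ 4|b|·K·log(1/η)`** for every
smooth action with `|S∘ι − c| ≤ b` (every volume), and `⟨S_W⟩_{x₀} − ⟨S_W⟩_{x_K} ≤ 4n·#plaq·K·log(1/η)`
for the Wilson action under `wilsonMeasure ρ₀ x`. -/
def T20_StaircaseMeanActionLaw : Prop :=
  (∀ (d L n : ℕ) [NeZero L] (S : AmbConfig d L n → ℝ), ContDiff ℝ ∞ S → ∀ (c b : ℝ),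
    (∀ U : GaugeConfig d L (Matrix.specialUnitaryGroup (Fin n) ℂ), |S (coeConfig U) - c| ≤ b) →
    ∀ (η : ℝ), 0 < η → η < 1 → ∀ (K : ℕ) (x : ℕ → ℝ), (∀ k < K, x k ≤ x (k + 1)) →
    (∀ k < K, Summable fun j : ℕ => (j.factorial : ℂ)⁻¹ *
      iteratedDeriv j (fun w => deriv (complexMGF (fun U => -S (coeConfig U))
          (trivialMeasure (Matrix.specialUnitaryGroup (Fin n) ℂ) d L)) w /
        complexMGF (fun U => -S (coeConfig U))
          (trivialMeasure (Matrix.specialUnitaryGroup (Fin n) ℂ) d L) w) (x k) *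
      (((x k + (x (k + 1) - x k) / (1 - η) : ℝ) : ℂ) - x k) ^ j) →
    (∫ U, S (coeConfig U) ∂(boltzmannMeasure fun U :
        GaugeConfig d L (Matrix.specialUnitaryGroup (Fin n) ℂ) => x 0 * S (coeConfig U))) -
      (∫ U, S (coeConfig U) ∂(boltzmannMeasure fun U :
        GaugeConfig d L (Matrix.specialUnitaryGroup (Fin n) ℂ) => x K * S (coeConfig U))) ≤
      4 * |b| * (K * Real.log (1 / η))) ∧
  (∀ (d L n : ℕ) [NeZero L] (η : ℝ), 0 < η → η < 1 → ∀ (K : ℕ) (x : ℕ → ℝ),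
    (∀ k < K, x k ≤ x (k + 1)) →
    (∀ k < K, Summable fun j : ℕ => (j.factorial : ℂ)⁻¹ *
      iteratedDeriv j (fun w => deriv (complexMGF
          (fun U => -TrivializingMaps.ambWilsonAction (coeConfig U))
          (trivialMeasure (Matrix.specialUnitaryGroup (Fin n) ℂ) d L)) w /
        complexMGF (fun U => -TrivializingMaps.ambWilsonAction (coeConfig U))
          (trivialMeasure (Matrix.specialUnitaryGroup (Fin n) ℂ) d L) w) (x k) *
      (((x k + (x (k + 1) - x k) / (1 - η) : ℝ) : ℂ) - x k) ^ j) →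
    (∫ U, wilsonAction (TrivializingMaps.StrongCoupling.defRep n) U
        ∂(wilsonMeasure (d := d) (L := L) (TrivializingMaps.StrongCoupling.defRep n) (x 0))) -
      (∫ U, wilsonAction (TrivializingMaps.StrongCoupling.defRep n) U
        ∂(wilsonMeasure (d := d) (L := L) (TrivializingMaps.StrongCoupling.defRep n) (x K))) ≤
      4 * (n * Fintype.card (Plaquette d L)) * (K * Real.log (1 / η)))

/-- T20 holds (`TrivializingMaps.Staircase.meanAction_drop_le`,
`TrivializingMaps.wilson_meanAction_drop_le`). -/
theorem T20_StaircaseMeanActionLaw_holds : T20_StaircaseMeanActionLaw :=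
  ⟨fun _ _ _ _ _ hS _ _ hb _ hη0 hη1 _ _ hmono hadm =>
      TrivializingMaps.Staircase.meanAction_drop_le hS hb hη0 hη1 hmono hadm,
    fun _ _ _ _ _ hη0 hη1 _ _ hmono hadm =>
      TrivializingMaps.wilson_meanAction_drop_le hη0 hη1 hmono hadm⟩

end PartT20

/-- **The theory conjunction with the two zero-free stage laws** (DRAFT):
`TheoryStatementT18 ∧ T19 ∧ T20`. -/
def TheoryStatementT20 : Prop :=
  TheoryStatementT18 ∧ T19_WilsonStaircaseCountExplicit ∧ T20_StaircaseMeanActionLaw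

/-- The extended theory conjunction holds. -/
theorem TheoryStatementT20_holds : TheoryStatementT20 :=
  ⟨TheoryStatementT18_holds, T19_WilsonStaircaseCountExplicit_holds, T20_StaircaseMeanActionLaw_holds⟩


/-! ### Appended (lean-2 GEN-7, third pass): Part T21 — THE FISHER ZEROS OF `Z_L` IN A FIXED DISC
ARE EXTENSIVE (`TrivializingMaps.wilson_fisherZeros_extensive`: Blaschke factors + coefficient
Borel–Carathéodory + Mathlib's divisor; `SU(2)`: `ρ²(1 − 8/R)·#plaq` zeros in `|s| < R`).  NOT
binding: the value of `ρ`; any count for a concrete volume. -/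

section PartT21

/-- **T21 — EXTENSIVE FISHER ZEROS: total multiplicity of the zeros of `Z_L` with `ρ ≤ |u| < R` is at
least `ρ²·(m₂(n) − 4n/R)·#plaquettes`, every `L ≥ 2`, with one `ρ > 0` for all volumes.** -/
def T21_WilsonFisherZerosExtensive : Prop :=
  ∀ (d n : ℕ), 2 ≤ n → ∀ (B : SuBasis n), ∃ ρ : ℝ, 0 < ρ ∧ ∀ (L : ℕ) [NeZero L], 2 ≤ L →
    ∀ R : ℝ, 0 < R →
      ∃ T : Finset ℂ, (∀ u ∈ T,
          complexMGF (fun U => -TrivializingMaps.ambWilsonAction (coeConfig U))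
              (trivialMeasure (Matrix.specialUnitaryGroup (Fin n) ℂ) d L) u = 0 ∧
            ρ ≤ ‖u‖ ∧ ‖u‖ < R ∧
            1 ≤ MeromorphicOn.divisor (complexMGF (fun U => -TrivializingMaps.ambWilsonAction
              (coeConfig U)) (trivialMeasure (Matrix.specialUnitaryGroup (Fin n) ℂ) d L))
              (Metric.closedBall (0 : ℂ) (2 * R)) u) ∧
        ρ ^ 2 * ((∫ g, ((g : Matrix (Fin n) (Fin n) ℂ)).trace.re ^ 2
            ∂(haarProbability (Matrix.specialUnitaryGroup (Fin n) ℂ))) - 4 * n / R) *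
            Fintype.card (Plaquette d L) ≤
          ∑ u ∈ T, (MeromorphicOn.divisor (complexMGF (fun U => -TrivializingMaps.ambWilsonAction
              (coeConfig U)) (trivialMeasure (Matrix.specialUnitaryGroup (Fin n) ℂ) d L))
              (Metric.closedBall (0 : ℂ) (2 * R)) u : ℝ)

/-- T21 holds (`TrivializingMaps.wilson_fisherZeros_extensive`). -/
theorem T21_WilsonFisherZerosExtensive_holds : T21_WilsonFisherZerosExtensive :=
  fun _ _ hn B => TrivializingMaps.wilson_fisherZeros_extensive hn B

end PartT21

/-- **The theory conjunction with the extensive-zeros theorem** (DRAFT): `TheoryStatementT20 ∧ T21`. -/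
def TheoryStatementT21 : Prop :=
  TheoryStatementT20 ∧ T21_WilsonFisherZerosExtensive

/-- The extended theory conjunction holds. -/
theorem TheoryStatementT21_holds : TheoryStatementT21 :=
  ⟨TheoryStatementT20_holds, T21_WilsonFisherZerosExtensive_holds⟩

end Summit.Ventures.LatticeQCDFlow
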